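import Literature.AlgebraicGeometry.HodgeTheory.CMHodgeGroupKWeilTrace
import Literature.AlgebraicGeometry.HodgeTheory.CMHodgeGroupNoBlockIntertwiner
import Literature.AlgebraicGeometry.HodgeTheory.CMHodgeGroupDerivedAlgebra
import Mathlib.Data.Matrix.Basis
import HarnessLib

/-!
# No equal-signature twist between a block and the conjugate of the other block of a `K`-Weil CM type with two places:
# the outer diagonal `W_{σ̄₂} ≅ W_{σ₁}` of the derived algebra is excluded by «`Lie Hg ⊆ 𝔰𝔲_K`» and the commutant theorem
# (TABLE X row 11; Moonen–Zarhin 1998 §4, 1999 §2–3; Ribet 1983 §3)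

Family `hodge`, layer `Literature/AlgebraicGeometry/HodgeTheory` (cell `pub-hodgeav-hg6`, req-37 (A) Q2b, TABLE X ROW 11 =
`IV(2,1).kE0`, design note `HOME/jobs/ROW11-Esquare-eng4g8/DESIGN.md`, brick R11-4 = the discharge, for the `K`-Weil members, of
the residual `NoEqualSignatureTwist` displayed by the eng-5 lineage's n₀ = 3 NoTwist brick). UNCONDITIONAL; theorems only, no
definition, no named fact, no `sorry`. HONEST FRAMING of that cell: HC / HC_AV / HC_CM / H2 NOT proved — linear algebra of
polarized weight-one `ℚ`-Hodge structures.

SETTING (eng-5's `CMTheta*` vocabulary): `H` effective polarized of weight `1`, `E = End_Hdg(V) = ℚ[φ]`, a CM type `μ : ι → ℂ`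
(blocks `W_c = ker(φ_ℂ − c)` of dimension `n₀`, spanning `V_ℂ` with their conjugates), an admissible bracket-closed `𝔤 ∋ Θ_ℂ`,
its derived set `𝔡 = {XX′ − X′X}` and `𝔇 = 𝔡_ℂ`. A TWIST DATUM between two blocks `W_a`, `W_b` is a linear isomorphism
`T : W_a ≃ W_b` intertwining the restrictions of every element of `𝔇` (the operator form of the twist alternative of
`LieGoursatTwist.lift_or_twist_of_submodules`, type I directly, type II after transposition through the `ψ`-dual basis).
* §1 `CMThetaKWeil.exists_eq_smul_one_of_forall_comm` — Schur for `𝔰𝔩`: an endomorphism commuting with every traceless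
  endomorphism is a scalar (`Matrix.mem_range_scalar_of_commute_single`).
* §2 **`CMThetaKWeil.exists_defect_of_intertwiner`** — if `𝔇` induces all of `𝔰𝔩(W_b)` on `W_b`, every `Y ∈ 𝔤_ℂ` has a
  SCALAR DEFECT along a twist datum `T : W_a ≃ W_b`: `Y ∘ T − T ∘ Y = c(Y) · T` on `W_a` (`[Y, 𝔇] ⊆ 𝔇` makes the defect
  `𝔇`-equivariant; Schur); **`CMThetaKWeil.trace_restrict_eq_add_of_intertwiner`** — hence `tr(Y|_{W_b}) = tr(Y|_{W_a}) +
  n₀ · c(Y)`.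
* §3 `CMThetaKWeil.trace_restrict_conj_eq_neg` — `tr(D|_{W_{μ̄ k}}) = −tr(D|_{W_{μ k}})` for `φ_ℂ`-commuting `ψ_ℂ`-skew `D`
  (dual-basis coordinates).
* §4 **`CMThetaKWeil.not_exists_intertwiner_conj_of_traceOrthogonal`** — two places `k₁ ≠ k₂` covering `ι`, `y ∈ E⁻` acting by
  one scalar `ν ≠ 0` on the CM type and `𝔤` trace-orthogonal to `y` («`𝔤 ⊆ 𝔰𝔲_K`», `CMHodgeGroupKWeilTrace`): there is NO
  twist datum `T : W_{μ̄ k₂} ≃ W_{μ k₁}` — for every `Y ∈ 𝔤_ℂ`, `n₀ c(Y) = tr Y|_{W_{μk₁}} − tr Y|_{W_{μ̄k₂}} = tr Y|_{W_{μk₁}} +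
  tr Y|_{W_{μk₂}} = 0`, so `T` commutes with all of `𝔤_ℂ` and vanishes by the commutant theorem
  (`CMThetaKWeil.linearMap_eigenspace_eq_zero`, `μ̄₂ ≠ μ₁`), contradicting `W ≠ 0`;
  **`CMThetaKWeil.not_exists_intertwiner_conj_hodgeLie`** — `𝔤 = Lie Hg`, UNCONDITIONAL under the `K`-Weil balance
  `(p₁ − q₁) + (p₂ − q₂) = 0` (the pattern `(2,1)+(1,2)`): the `K`-Weil members of TABLE X rows 10∕11 have no outer twist.
  For `E` without an imaginary quadratic subfield (row 10, cyclic ∕ `D₄` quartic) nothing is claimed here.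

## References
* [MoonenZarhin1998WeilClasses] B. Moonen, Yu. Zarhin, J. reine angew. Math. 496 (1998), §4 Remark (1).
* [MoonenZarhin1999LowDim] B. Moonen, Yu. Zarhin, Math. Ann. 315 (1999), §2 (2.3), §3 proof of Lemma (3.4), (3.1).
* [Ribet1983] K. A. Ribet, Amer. J. Math. 105 (1983), §3 (Lie algebra lemma), Thm. 0.
* [Deligne1982HodgeCycles] P. Deligne, LNM 900 (1982), I §3 Prop. 3.4, §4 (p. 30).
* [Humphreys1972] J. E. Humphreys, GTM 9 (1972), §1.2 (the basis `e_{ij}` of `𝔰𝔩(ℓ+1, F)`), §6.1 (Schur's Lemma).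
-/

noncomputable section

open scoped TensorProduct
open Module

namespace Literature.AlgebraicGeometry.Motives

namespace HodgeStructure

universe u

/-! ### §1 Schur for `𝔰𝔩` -/

/-- **An endomorphism commuting with every traceless endomorphism is a scalar** (Schur's lemma for the irreducible standard
module of `𝔰𝔩(W)`: it commutes with the off-diagonal matrix units `e_{ij}`, `i ≠ j`, of a basis — Humphreys' basis of `𝔰𝔩(ℓ+1, F)`
— hence is scalar; `Matrix.mem_range_scalar_of_commute_single`). [cite: Humphreys1972, §1.2 and §6.1 (Schur's Lemma)] -/
theorem CMThetaKWeil.exists_eq_smul_one_of_forall_comm {W : Type*} [AddCommGroup W] [Module ℂ W] [FiniteDimensional ℂ W]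
    (M : Module.End ℂ W) (hM : ∀ Z : Module.End ℂ W, LinearMap.trace ℂ W Z = 0 → M * Z = Z * M) :
    ∃ c : ℂ, M = c • 1 := by
  classical
  set b := Module.finBasis ℂ W with hb
  set A := LinearMap.toMatrix b b M with hA
  have hcomm : Pairwise fun i j => Commute (Matrix.single i j (1 : ℂ)) A := by
    intro i j hij
    have hZ : LinearMap.trace ℂ W (Matrix.toLin b b (Matrix.single i j (1 : ℂ))) = 0 := by
      rw [LinearMap.trace_eq_matrix_trace ℂ b, LinearMap.toMatrix_toLin, Matrix.trace_single_eq_of_ne _ _ _ hij]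
    have h := hM _ hZ
    have h' := congrArg (LinearMap.toMatrix b b) h
    rw [LinearMap.toMatrix_mul, LinearMap.toMatrix_mul, LinearMap.toMatrix_toLin] at h'
    exact h'.symm
  obtain ⟨c, hc⟩ := Matrix.mem_range_scalar_of_commute_single hcomm
  refine ⟨c, (LinearMap.toMatrix b b).injective ?_⟩
  rw [← hA, ← hc, LinearEquiv.map_smul, LinearMap.toMatrix_one, Matrix.scalar_apply, ← Matrix.smul_one_eq_diagonal]

variable {V : Type u} [AddCommGroup V] [Module ℚ V] {n : ℤ}

/-! ### §2 The scalar defect of `𝔤_ℂ` along a twist datum -/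

/-- **THE SCALAR DEFECT ALONG A TWIST DATUM.** `φ ∈ End_Hdg(V)`, `𝔤` bracket-closed commuting with `End_Hdg(V)`, `𝔡` its derived set,
`W_a`, `W_b` two eigenspaces of `φ_ℂ` with `𝔡_ℂ|_{W_b} ⊇ 𝔰𝔩(W_b)` (`hproj`), and `T : W_a ≃ W_b` intertwining every element of
`𝔡_ℂ`. Then for every `Y ∈ 𝔤_ℂ` there is `c ∈ ℂ` with `Y(Tw) − T(Yw) = c · Tw` for all `w ∈ W_a`: the defect `D_Y = Y ∘ T − T ∘ Y`
is again `𝔡_ℂ`-equivariant because `[Y, X] ∈ 𝔡_ℂ` for `X ∈ 𝔡_ℂ`, so `D_Y ∘ T⁻¹` commutes with `𝔰𝔩(W_b)` and is a scalar (§1).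
(Ribet's Lie-algebra lemma: a twist of the derived algebra is rigid up to the centre.) [cite: Ribet1983, §3]
[cite: MoonenZarhin1999LowDim, §2 (2.3)] -/
theorem CMThetaKWeil.exists_defect_of_intertwiner [Module.Finite ℚ V] (H : HodgeStructure V n) {φ : Module.End ℚ V}
    (hφE : φ ∈ H.endAlg) (𝔤 : Submodule ℚ (Module.End ℚ V)) (hbr : ∀ X ∈ 𝔤, ∀ X' ∈ 𝔤, X * X' - X' * X ∈ 𝔤)
    (hcomm : ∀ X ∈ 𝔤, ∀ e : H.endAlg, X * (e : Module.End ℚ V) = (e : Module.End ℚ V) * X) {a b : ℂ}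
    (hproj : ∀ Z : Module.End ℂ ↥(Module.End.eigenspace (φ.baseChange ℂ) b), LinearMap.trace ℂ _ Z = 0 →
      ∃ X ∈ spanC (Submodule.span ℚ {B | ∃ X ∈ 𝔤, ∃ X' ∈ 𝔤, X * X' - X' * X = B}),
        ∀ w : ↥(Module.End.eigenspace (φ.baseChange ℂ) b), X w = Z w)
    (T : ↥(Module.End.eigenspace (φ.baseChange ℂ) a) ≃ₗ[ℂ] ↥(Module.End.eigenspace (φ.baseChange ℂ) b))
    (hT : ∀ X ∈ spanC (Submodule.span ℚ {B | ∃ X ∈ 𝔤, ∃ X' ∈ 𝔤, X * X' - X' * X = B}),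
      ∀ w w₁ : ↥(Module.End.eigenspace (φ.baseChange ℂ) a), (w₁ : ℂ ⊗[ℚ] V) = X w → (T w₁ : ℂ ⊗[ℚ] V) = X (T w))
    {Y : Module.End ℂ (ℂ ⊗[ℚ] V)} (hY : Y ∈ spanC 𝔤) :
    ∃ c : ℂ, ∀ w w₁ : ↥(Module.End.eigenspace (φ.baseChange ℂ) a), (w₁ : ℂ ⊗[ℚ] V) = Y w →
      Y (T w) - T w₁ = c • (T w : ℂ ⊗[ℚ] V) := by
  classical
  set 𝔡 : Submodule ℚ (Module.End ℚ V) := Submodule.span ℚ {B | ∃ X ∈ 𝔤, ∃ X' ∈ 𝔤, X * X' - X' * X = B} with h𝔡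
  have h𝔇𝔊 : spanC 𝔡 ≤ spanC 𝔤 := spanC_mono (CMDerived.derived_le hbr)
  -- elements of `𝔤_ℂ` preserve the eigenspaces
  have hSφ : ∀ Z ∈ spanC 𝔤, Z * φ.baseChange ℂ = φ.baseChange ℂ * Z := fun Z hZ =>
    UnitaryTheta.commute_of_mem_spanC H hφE hcomm hZ
  have hSW : ∀ Z ∈ spanC 𝔤, ∀ c, ∀ w ∈ Module.End.eigenspace (φ.baseChange ℂ) c,
      Z w ∈ Module.End.eigenspace (φ.baseChange ℂ) c := fun Z hZ c w hw =>
    UnitaryTheta.apply_mem_eigenspace_of_commute (hSφ Z hZ) hw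
  -- restrictions to `W_a` and `W_b`
  let ra : ∀ Z, Z ∈ spanC 𝔤 → Module.End ℂ ↥(Module.End.eigenspace (φ.baseChange ℂ) a) :=
    fun Z hZ => Z.restrict (hSW Z hZ a)
  let rb : ∀ Z, Z ∈ spanC 𝔤 → Module.End ℂ ↥(Module.End.eigenspace (φ.baseChange ℂ) b) :=
    fun Z hZ => Z.restrict (hSW Z hZ b)
  have hra : ∀ Z hZ (w : ↥(Module.End.eigenspace (φ.baseChange ℂ) a)), ((ra Z hZ w : _) : ℂ ⊗[ℚ] V) = Z w :=
    fun Z hZ w => rfl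
  have hrb : ∀ Z hZ (w : ↥(Module.End.eigenspace (φ.baseChange ℂ) b)), ((rb Z hZ w : _) : ℂ ⊗[ℚ] V) = Z w :=
    fun Z hZ w => rfl
  let Ta : ↥(Module.End.eigenspace (φ.baseChange ℂ) a) →ₗ[ℂ] ↥(Module.End.eigenspace (φ.baseChange ℂ) b) := T.toLinearMap
  let Ti : ↥(Module.End.eigenspace (φ.baseChange ℂ) b) →ₗ[ℂ] ↥(Module.End.eigenspace (φ.baseChange ℂ) a) :=
    T.symm.toLinearMap
  have hTa : ∀ w, Ta w = T w := fun w => rfl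
  have hTiTa : ∀ w, Ti (Ta w) = w := fun w => T.symm_apply_apply w
  have hTaTi : ∀ w, Ta (Ti w) = w := fun w => T.apply_symm_apply w
  -- `T` intertwines `𝔇`: `Ta ∘ Xa = Xb ∘ Ta`
  have hTX : ∀ X (hX : X ∈ spanC 𝔡) (w : ↥(Module.End.eigenspace (φ.baseChange ℂ) a)),
      Ta (ra X (h𝔇𝔊 hX) w) = rb X (h𝔇𝔊 hX) (Ta w) := fun X hX w =>
    Subtype.ext (hT X hX w _ (hra X (h𝔇𝔊 hX) w))
  have hTiX : ∀ X (hX : X ∈ spanC 𝔡) (w : ↥(Module.End.eigenspace (φ.baseChange ℂ) b)),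
      Ti (rb X (h𝔇𝔊 hX) w) = ra X (h𝔇𝔊 hX) (Ti w) := fun X hX w => by
    have h := hTX X hX (Ti w)
    rw [hTaTi] at h
    rw [← h, hTiTa]
  -- the defect `D = Yb ∘ Ta − Ta ∘ Ya`
  let D : ↥(Module.End.eigenspace (φ.baseChange ℂ) a) →ₗ[ℂ] ↥(Module.End.eigenspace (φ.baseChange ℂ) b) :=
    rb Y hY ∘ₗ Ta - Ta ∘ₗ ra Y hY
  have hDapply : ∀ w : ↥(Module.End.eigenspace (φ.baseChange ℂ) a), (D w : ℂ ⊗[ℚ] V) = Y (T w) - (T (ra Y hY w) : ℂ ⊗[ℚ] V) :=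
    fun w => rfl
  -- `D` is `𝔇`-equivariant
  have hDX : ∀ X (hX : X ∈ spanC 𝔡) (w : ↥(Module.End.eigenspace (φ.baseChange ℂ) a)),
      D (ra X (h𝔇𝔊 hX) w) = rb X (h𝔇𝔊 hX) (D w) := by
    intro X hX w
    have hXg := h𝔇𝔊 hX
    -- `[Y, X] ∈ 𝔇`, and `T` intertwines it
    have hC : Y * X - X * Y ∈ spanC 𝔡 := commutator_mem_spanC_derived hY hXg
    have e1 := congrArg Subtype.val (hTX _ hC w)
    have h5 : ra (Y * X - X * Y) (h𝔇𝔊 hC) w = ra Y hY (ra X hXg w) - ra X hXg (ra Y hY w) := Subtype.ext rfl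
    rw [h5, map_sub, Submodule.coe_sub] at e1
    have e2 := congrArg Subtype.val (hTX X hX w)
    have e3 := congrArg Subtype.val (hTX X hX (ra Y hY w))
    -- everything in `V_ℂ`
    change (T (ra Y hY (ra X hXg w)) : ℂ ⊗[ℚ] V) - (T (ra X hXg (ra Y hY w)) : ℂ ⊗[ℚ] V) =
      (Y * X - X * Y) (T w : ℂ ⊗[ℚ] V) at e1
    change (T (ra X hXg w) : ℂ ⊗[ℚ] V) = X (T w : ℂ ⊗[ℚ] V) at e2
    change (T (ra X hXg (ra Y hY w)) : ℂ ⊗[ℚ] V) = X (T (ra Y hY w) : ℂ ⊗[ℚ] V) at e3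
    apply Subtype.ext
    change Y (T (ra X hXg w) : ℂ ⊗[ℚ] V) - (T (ra Y hY (ra X hXg w)) : ℂ ⊗[ℚ] V) =
      X (Y (T w : ℂ ⊗[ℚ] V) - (T (ra Y hY w) : ℂ ⊗[ℚ] V))
    rw [LinearMap.sub_apply, Module.End.mul_apply, Module.End.mul_apply] at e1
    have e4 : (T (ra Y hY (ra X hXg w)) : ℂ ⊗[ℚ] V) = Y (X (T w : ℂ ⊗[ℚ] V)) - X (Y (T w : ℂ ⊗[ℚ] V)) +
        X (T (ra Y hY w) : ℂ ⊗[ℚ] V) := by rw [← e3]; exact (sub_eq_iff_eq_add.1 e1)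
    rw [e4, e2, map_sub]
    abel
  let N : Module.End ℂ ↥(Module.End.eigenspace (φ.baseChange ℂ) b) := D ∘ₗ Ti
  have hNX : ∀ X (hX : X ∈ spanC 𝔡), N * rb X (h𝔇𝔊 hX) = rb X (h𝔇𝔊 hX) * N := fun X hX =>
    LinearMap.ext fun w => by
      change D (Ti (rb X (h𝔇𝔊 hX) w)) = rb X (h𝔇𝔊 hX) (D (Ti w))
      rw [hTiX X hX w, hDX X hX]
  -- Schur on `W_b`
  have hNZ : ∀ Z : Module.End ℂ ↥(Module.End.eigenspace (φ.baseChange ℂ) b), LinearMap.trace ℂ _ Z = 0 →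
      N * Z = Z * N := by
    intro Z hZ
    obtain ⟨X, hX, hXZ⟩ := hproj Z hZ
    have hZeq : rb X (h𝔇𝔊 hX) = Z := LinearMap.ext fun w => Subtype.ext (hXZ w)
    rw [← hZeq]
    exact hNX X hX
  obtain ⟨c, hc⟩ := CMThetaKWeil.exists_eq_smul_one_of_forall_comm N hNZ
  refine ⟨c, fun w w₁ hw₁ => ?_⟩
  have hDw : D w = c • Ta w := by
    have h := LinearMap.congr_fun hc (Ta w)
    rw [LinearMap.smul_apply, Module.End.one_apply] at h
    rw [← h]
    change D w = D (Ti (Ta w))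
    rw [hTiTa]
  have hw₁' : w₁ = ra Y hY w := Subtype.ext hw₁
  have h := congrArg Subtype.val hDw
  rw [hDapply, Submodule.coe_smul, ← hw₁'] at h
  exact h

/-- **Trace form of the defect**: in the setting of `CMThetaKWeil.exists_defect_of_intertwiner`, with the defect scalar `c` of
`Y ∈ 𝔤_ℂ` along `T : W_a ≃ W_b`, `tr(Y|_{W_b}) = tr(Y|_{W_a}) + dim W_a · c` (`Y|_{W_b} = T ∘ (Y|_{W_a} + c) ∘ T⁻¹`).
[cite: Ribet1983, §3] [cite: MoonenZarhin1999LowDim, §2 (2.3)] -/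
theorem CMThetaKWeil.trace_restrict_eq_add_of_intertwiner (H : HodgeStructure V n) {φ : Module.End ℚ V}
    (hφE : φ ∈ H.endAlg) (𝔤 : Submodule ℚ (Module.End ℚ V))
    (hcomm : ∀ X ∈ 𝔤, ∀ e : H.endAlg, X * (e : Module.End ℚ V) = (e : Module.End ℚ V) * X) {a b : ℂ}
    [FiniteDimensional ℂ ↥(Module.End.eigenspace (φ.baseChange ℂ) a)]
    [FiniteDimensional ℂ ↥(Module.End.eigenspace (φ.baseChange ℂ) b)]
    (T : ↥(Module.End.eigenspace (φ.baseChange ℂ) a) ≃ₗ[ℂ] ↥(Module.End.eigenspace (φ.baseChange ℂ) b))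
    {Y : Module.End ℂ (ℂ ⊗[ℚ] V)} (hY : Y ∈ spanC 𝔤) {c : ℂ}
    (hc : ∀ w w₁ : ↥(Module.End.eigenspace (φ.baseChange ℂ) a), (w₁ : ℂ ⊗[ℚ] V) = Y w →
      Y (T w) - T w₁ = c • (T w : ℂ ⊗[ℚ] V)) :
    LinearMap.trace ℂ _ (Y.restrict fun x (hx : x ∈ Module.End.eigenspace (φ.baseChange ℂ) b) =>
        UnitaryTheta.apply_mem_eigenspace_of_commute (UnitaryTheta.commute_of_mem_spanC H hφE hcomm hY) hx) =
      LinearMap.trace ℂ _ (Y.restrict fun x (hx : x ∈ Module.End.eigenspace (φ.baseChange ℂ) a) =>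
        UnitaryTheta.apply_mem_eigenspace_of_commute (UnitaryTheta.commute_of_mem_spanC H hφE hcomm hY) hx) +
      (Module.finrank ℂ ↥(Module.End.eigenspace (φ.baseChange ℂ) a) : ℂ) * c := by
  have hYφ : Y * φ.baseChange ℂ = φ.baseChange ℂ * Y := UnitaryTheta.commute_of_mem_spanC H hφE hcomm hY
  let Ya : Module.End ℂ ↥(Module.End.eigenspace (φ.baseChange ℂ) a) :=
    Y.restrict fun x (hx : x ∈ Module.End.eigenspace (φ.baseChange ℂ) a) => UnitaryTheta.apply_mem_eigenspace_of_commute hYφ hx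
  let Yb : Module.End ℂ ↥(Module.End.eigenspace (φ.baseChange ℂ) b) :=
    Y.restrict fun x (hx : x ∈ Module.End.eigenspace (φ.baseChange ℂ) b) => UnitaryTheta.apply_mem_eigenspace_of_commute hYφ hx
  -- `Yb = T ∘ (Ya + c) ∘ T⁻¹`
  have hconj : Yb = T.conj (Ya + c • 1) := by
    refine LinearMap.ext fun v => ?_
    rw [LinearEquiv.conj_apply, LinearMap.comp_apply, LinearMap.comp_apply, LinearEquiv.coe_coe, LinearEquiv.coe_coe,
      LinearMap.add_apply, LinearMap.smul_apply, Module.End.one_apply, map_add, map_smul]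
    apply Subtype.ext
    have h := hc (T.symm v) (Ya (T.symm v)) rfl
    rw [LinearEquiv.apply_symm_apply] at h
    change Y (v : ℂ ⊗[ℚ] V) = ((T (Ya (T.symm v)) + c • T (T.symm v) : ↥(Module.End.eigenspace (φ.baseChange ℂ) b)) :
      ℂ ⊗[ℚ] V)
    rw [Submodule.coe_add, Submodule.coe_smul, LinearEquiv.apply_symm_apply]
    exact sub_eq_iff_eq_add'.1 h
  change LinearMap.trace ℂ _ Yb = LinearMap.trace ℂ _ Ya + _
  rw [hconj, LinearMap.trace_conj', map_add, map_smul, LinearMap.trace_one, smul_eq_mul, mul_comm]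

/-! ### §3 Traces on conjugate blocks -/

/-- **`tr(D|_{W_{μ̄ k}}) = −tr(D|_{W_{μ k}})`** for a `φ_ℂ`-commuting `ψ_ℂ`-skew `D` and a CM type `μ` of `E = ℚ[φ]`: in an adapted
dual basis the diagonal coordinates of `D` on `W_{μ̄ k}` are minus those on `W_{μ k}` (`CMArith.repr_zero_eq` / `repr_one_eq`).
[cite: Deligne1982HodgeCycles, §4 (p. 30)] [cite: MoonenZarhin1999LowDim, §1] -/
theorem CMThetaKWeil.trace_restrict_conj_eq_neg [Module.Finite ℚ V] [HodgeTensorFacts.{u, u}] {ι : Type} [Fintype ι]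
    [DecidableEq ι] (H : HodgeStructure V n) (hn : n = 1) (heff : H.IsEffective) (ψ : H.Polarization)
    {φ : Module.End ℚ V} (hφE : φ ∈ H.endAlg) {m : ℕ} (hE : ∀ a ∈ H.endAlg, ∃ q : Fin m → ℚ, a = ∑ k, q k • φ ^ (k : ℕ))
    (μ : ι → ℂ) (hinj : Function.Injective μ) (hdist : ∀ k k', μ k' ≠ starRingEnd ℂ (μ k)) {n₀ : ℕ}
    (hrank : ∀ k, Module.finrank ℂ ↥(Module.End.eigenspace (φ.baseChange ℂ) (μ k) ⊓ H.piece 1 0) +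
      Module.finrank ℂ ↥(Module.End.eigenspace (φ.baseChange ℂ) (μ k) ⊓ H.piece 0 1) = n₀)
    (htop : (⨆ kt : ι × Fin 2, Module.End.eigenspace (φ.baseChange ℂ)
      (if kt.2 = 0 then μ kt.1 else starRingEnd ℂ (μ kt.1))) = ⊤)
    {D : Module.End ℂ (ℂ ⊗[ℚ] V)} (hDφ : D * φ.baseChange ℂ = φ.baseChange ℂ * D)
    (hDskew : ∀ x y, ψ.form.baseChange ℂ (D x) y + ψ.form.baseChange ℂ x (D y) = 0) (k : ι) :
    LinearMap.trace ℂ _ (D.restrict fun x (hx : x ∈ Module.End.eigenspace (φ.baseChange ℂ) (starRingEnd ℂ (μ k))) =>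
        UnitaryTheta.apply_mem_eigenspace_of_commute hDφ hx) =
      -LinearMap.trace ℂ _ (D.restrict fun x (hx : x ∈ Module.End.eigenspace (φ.baseChange ℂ) (μ k)) =>
        UnitaryTheta.apply_mem_eigenspace_of_commute hDφ hx) := by
  classical
  set F := φ.baseChange ℂ with hF
  obtain ⟨cb, κ, hcbW, hcbW', -, -, hdual, hiso⟩ :=
    CMTheta.exists_adaptedDualBasis H hn heff ψ hφE hE μ hinj hdist hrank htop
  have hfin : Module.finrank ℂ ↥(Module.End.eigenspace F (μ k)) = n₀ := by
    rw [hF, CMTheta.finrank_eigenspace_eq_add H hn heff hφE, hrank k]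
  have hfin' : Module.finrank ℂ ↥(Module.End.eigenspace F (starRingEnd ℂ (μ k))) = n₀ := by
    rw [← hfin, hF, ← finrank_eigenspace_baseChange_conj_eq starRingAut φ (μ k), starRingAut_apply, starRingEnd_apply]
  have he0 : Function.Injective (fun j : Fin n₀ => (((k, (0 : Fin 2)), j) : (ι × Fin 2) × Fin n₀)) :=
    fun j j' h => by simpa using h
  have he1 : Function.Injective (fun j : Fin n₀ => (((k, (1 : Fin 2)), j) : (ι × Fin 2) × Fin n₀)) :=
    fun j j' h => by simpa using h
  rw [CMArith.trace_restrict_eq_sum_repr cb _ he1 _ (hcbW' k) hfin' D, CMArith.trace_restrict_eq_sum_repr cb _ he0 _ (hcbW k)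
    hfin D, ← Finset.sum_neg_distrib]
  refine Finset.sum_congr rfl fun j _ => ?_
  rw [CMArith.repr_one_eq cb (ψ.form.baseChange ℂ) hdual hiso, CMArith.repr_zero_eq cb (ψ.form.baseChange ℂ) hdual hiso]
  linear_combination hDskew (cb ((k, 0), j)) (cb ((k, 1), j))

/-! ### §4 No twist datum `W_{μ̄ k₂} ≃ W_{μ k₁}` for a `K`-Weil CM type with two places -/

/-- `Fin 2 = {0, 1}`. [folklore] -/
private theorem CMThetaKWeil.fin2_cases (r : Fin 2) : r = 0 ∨ r = 1 := by
  rcases r with ⟨_ | _ | k, hk⟩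
  · exact Or.inl rfl
  · exact Or.inr rfl
  · omega

/-- **NO OUTER TWIST FOR A `K`-WEIL CM TYPE WITH TWO PLACES, GIVEN «`𝔤 ⊆ 𝔰𝔲_K`».** `H` effective polarized of weight `1`,
`E = ℚ[φ]`, CM type `μ` with `ι = {k₁, k₂}` and blocks of dimension `n₀ ≠ 0`, `y ∈ E` `ψ`-skew acting by ONE scalar `ν ≠ 0` on
`W_{μ k₁}` and `W_{μ k₂}`; `𝔤` admissible bracket-closed with `Θ ∈ 𝔤_ℂ`, trace-orthogonal to `y` (`Tr(yX) = 0` on `𝔤`), and whose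
derived span induces all of `𝔰𝔩(W_{μ k₁})` on `W_{μ k₁}`. Then there is NO linear isomorphism `T : W_{μ̄ k₂} ≃ W_{μ k₁}` intertwining
the derived span `𝔡_ℂ`: its scalar defects vanish (`n₀ c(Y) = tr Y|_{W_{μk₁}} + tr Y|_{W_{μk₂}} = 0` by §2, §3 and
`CMThetaKWeil.trace_restrict_add_eq_zero`), so `T` commutes with `𝔤_ℂ` and is `0` (`CMThetaKWeil.linearMap_eigenspace_eq_zero`).
[cite: MoonenZarhin1998WeilClasses, §4 Remark (1)] [cite: MoonenZarhin1999LowDim, §3 proof of Lemma (3.4)] [cite: Ribet1983, §3] -/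
theorem CMThetaKWeil.not_exists_intertwiner_conj_of_traceOrthogonal [Module.Finite ℚ V] [HodgeTensorFacts.{u, u}] {ι : Type}
    [Fintype ι] [DecidableEq ι] (H : HodgeStructure V n) (hn : n = 1) (heff : H.IsEffective) (ψ : H.Polarization)
    {φ : Module.End ℚ V} (hφE : φ ∈ H.endAlg) {m : ℕ} (hE : ∀ a ∈ H.endAlg, ∃ q : Fin m → ℚ, a = ∑ k, q k • φ ^ (k : ℕ))
    (μ : ι → ℂ) (hinj : Function.Injective μ) (hdist : ∀ k k', μ k' ≠ starRingEnd ℂ (μ k)) {n₀ : ℕ} (hn₀ : n₀ ≠ 0)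
    (hrank : ∀ k, Module.finrank ℂ ↥(Module.End.eigenspace (φ.baseChange ℂ) (μ k) ⊓ H.piece 1 0) +
      Module.finrank ℂ ↥(Module.End.eigenspace (φ.baseChange ℂ) (μ k) ⊓ H.piece 0 1) = n₀)
    (htop : (⨆ kt : ι × Fin 2, Module.End.eigenspace (φ.baseChange ℂ)
      (if kt.2 = 0 then μ kt.1 else starRingEnd ℂ (μ kt.1))) = ⊤)
    {y : Module.End ℚ V} (hyskew : ∀ v w, ψ.form (y v) w + ψ.form v (y w) = 0) {ν : ℂ} (hν : ν ≠ 0)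
    (hyν : ∀ k, ∀ w ∈ Module.End.eigenspace (φ.baseChange ℂ) (μ k), y.baseChange ℂ w = ν • w)
    (k₁ k₂ : ι) (hk : k₁ ≠ k₂) (hι : ∀ k, k = k₁ ∨ k = k₂)
    (𝔤 : Submodule ℚ (Module.End ℚ V)) (hbr : ∀ X ∈ 𝔤, ∀ X' ∈ 𝔤, X * X' - X' * X ∈ 𝔤)
    (hcomm : ∀ X ∈ 𝔤, ∀ a : H.endAlg, X * (a : Module.End ℚ V) = (a : Module.End ℚ V) * X)
    (hskew : ∀ X ∈ 𝔤, ∀ v w, ψ.form (X v) w + ψ.form v (X w) = 0)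
    {Θ : Module.End ℂ (ℂ ⊗[ℚ] V)} (hΘ : ∀ p, ∀ x ∈ H.piece p (n - p), Θ x = ((2 * p - n : ℤ) : ℂ) • x)
    (hΘ𝔤 : Θ ∈ spanC 𝔤) (hy𝔤 : ∀ X ∈ 𝔤, LinearMap.trace ℚ V (y * X) = 0)
    (hproj : ∀ Z : Module.End ℂ ↥(Module.End.eigenspace (φ.baseChange ℂ) (μ k₁)), LinearMap.trace ℂ _ Z = 0 →
      ∃ X ∈ spanC (Submodule.span ℚ {B | ∃ X ∈ 𝔤, ∃ X' ∈ 𝔤, X * X' - X' * X = B}),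
        ∀ w : ↥(Module.End.eigenspace (φ.baseChange ℂ) (μ k₁)), X w = Z w) :
    ¬ ∃ T : ↥(Module.End.eigenspace (φ.baseChange ℂ) (starRingEnd ℂ (μ k₂))) ≃ₗ[ℂ]
        ↥(Module.End.eigenspace (φ.baseChange ℂ) (μ k₁)),
      ∀ X ∈ spanC (Submodule.span ℚ {B | ∃ X ∈ 𝔤, ∃ X' ∈ 𝔤, X * X' - X' * X = B}),
        ∀ w w₁ : ↥(Module.End.eigenspace (φ.baseChange ℂ) (starRingEnd ℂ (μ k₂))),
          (w₁ : ℂ ⊗[ℚ] V) = X w → (T w₁ : ℂ ⊗[ℚ] V) = X (T w) := by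
  classical
  rintro ⟨T, hT⟩
  have hfin : ∀ k, Module.finrank ℂ ↥(Module.End.eigenspace (φ.baseChange ℂ) (μ k)) = n₀ := fun k => by
    rw [CMTheta.finrank_eigenspace_eq_add H hn heff hφE, hrank k]
  have hfina : Module.finrank ℂ ↥(Module.End.eigenspace (φ.baseChange ℂ) (starRingEnd ℂ (μ k₂))) = n₀ := by
    rw [← hfin k₂, ← finrank_eigenspace_baseChange_conj_eq starRingAut φ (μ k₂), starRingAut_apply, starRingEnd_apply]
  have hSφ : ∀ Z ∈ spanC 𝔤, Z * φ.baseChange ℂ = φ.baseChange ℂ * Z := fun Z hZ =>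
    UnitaryTheta.commute_of_mem_spanC H hφE hcomm hZ
  -- every element of `𝔤_ℂ` has defect zero along `T`
  have hzero : ∀ Y (hY : Y ∈ spanC 𝔤), ∀ w w₁ : ↥(Module.End.eigenspace (φ.baseChange ℂ) (starRingEnd ℂ (μ k₂))),
      (w₁ : ℂ ⊗[ℚ] V) = Y w → Y (T w) - T w₁ = 0 := by
    intro Y hY w w₁ hw₁
    obtain ⟨c, hc⟩ := CMThetaKWeil.exists_defect_of_intertwiner H hφE 𝔤 hbr hcomm hproj T hT hY
    have htr := CMThetaKWeil.trace_restrict_eq_add_of_intertwiner H hφE 𝔤 hcomm T hY hc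
    have hskewY : ∀ x z, ψ.form.baseChange ℂ (Y x) z + ψ.form.baseChange ℂ x (Y z) = 0 := fun x z =>
      ThetaSubalgebra.formBaseChange_add_eq_zero_of_mem_spanC ψ hskew hY x z
    have hconj := CMThetaKWeil.trace_restrict_conj_eq_neg H hn heff ψ hφE hE μ hinj hdist hrank htop (hSφ Y hY) hskewY k₂
    have hsum := CMThetaKWeil.trace_restrict_add_eq_zero H hn heff ψ hφE hE μ hinj hdist hrank htop hyskew hν hyν k₁ k₂ hk hι 𝔤
      hcomm hskew hy𝔤 hY
    rw [hconj, hfina] at htr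
    have hc0 : (n₀ : ℂ) * c = 0 := by linear_combination hsum - htr
    have hc0' : c = 0 := (mul_eq_zero.1 hc0).resolve_left (Nat.cast_ne_zero.2 hn₀)
    have h := hc w w₁ hw₁
    rw [hc0', zero_smul] at h
    exact h
  -- so `T` commutes with every `X_ℂ`, `X ∈ 𝔤`; transport to the `ι × Fin 2`-indexed family and apply the commutant theorem
  set ev : ι × Fin 2 → ℂ := fun kt => if kt.2 = 0 then μ kt.1 else starRingEnd ℂ (μ kt.1) with hevdef
  have hev0 : ∀ k, ev (k, 0) = μ k := fun k => by simp [hevdef]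
  have hev1 : ∀ k, ev (k, 1) = starRingEnd ℂ (μ k) := fun k => by simp [hevdef]
  have hev : Function.Injective ev := by
    rintro ⟨k, t⟩ ⟨k', t'⟩ h
    rcases CMThetaKWeil.fin2_cases t with rfl | rfl <;> rcases CMThetaKWeil.fin2_cases t' with rfl | rfl
    · rw [hev0, hev0] at h; rw [hinj h]
    · rw [hev0, hev1] at h; exact absurd h (hdist k' k)
    · rw [hev1, hev0] at h; exact absurd h.symm (hdist k k')
    · rw [hev1, hev1] at h; rw [hinj ((starRingEnd ℂ).injective h)]
  have hWa' : Module.End.eigenspace (φ.baseChange ℂ) (ev (k₂, 1)) =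
      Module.End.eigenspace (φ.baseChange ℂ) (starRingEnd ℂ (μ k₂)) := by rw [hev1]
  have hWb' : Module.End.eigenspace (φ.baseChange ℂ) (ev (k₁, 0)) = Module.End.eigenspace (φ.baseChange ℂ) (μ k₁) := by
    rw [hev0]
  let f : ↥(Module.End.eigenspace (φ.baseChange ℂ) (ev (k₂, 1))) →ₗ[ℂ] ↥(Module.End.eigenspace (φ.baseChange ℂ) (ev (k₁, 0))) :=
    (LinearEquiv.ofEq _ _ hWb'.symm).toLinearMap ∘ₗ T.toLinearMap ∘ₗ (LinearEquiv.ofEq _ _ hWa').toLinearMap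
  have hfapply : ∀ w : ↥(Module.End.eigenspace (φ.baseChange ℂ) (ev (k₂, 1))),
      (f w : ℂ ⊗[ℚ] V) = T (LinearEquiv.ofEq _ _ hWa' w) := fun w => by
    change ((LinearEquiv.ofEq _ _ hWb'.symm (T (LinearEquiv.ofEq _ _ hWa' w)) : _) : ℂ ⊗[ℚ] V) = _
    rw [LinearEquiv.coe_ofEq_apply]
  have hEcomm : ∀ a ∈ H.endAlg, a * φ = φ * a := fun a ha => CMThetaCentre.mul_comm_of_hE H hE ha hφE
  have hf0 := CMThetaKWeil.linearMap_eigenspace_eq_zero H hφE hEcomm ev hev htop 𝔤 hΘ hΘ𝔤 hcomm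
    (a := (k₂, 1)) (b := (k₁, 0)) (fun h => hk.symm (Prod.mk.inj h).1) f (fun X hX w w₁ hw₁ => by
      rw [hfapply, hfapply]
      have hw₁' : ((LinearEquiv.ofEq _ _ hWa' w₁ : ↥(Module.End.eigenspace (φ.baseChange ℂ) (starRingEnd ℂ (μ k₂)))) :
          ℂ ⊗[ℚ] V) = X.baseChange ℂ (LinearEquiv.ofEq _ _ hWa' w :
            ↥(Module.End.eigenspace (φ.baseChange ℂ) (starRingEnd ℂ (μ k₂)))) := by
        rw [LinearEquiv.coe_ofEq_apply, LinearEquiv.coe_ofEq_apply]; exact hw₁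
      have h := hzero (X.baseChange ℂ) (baseChange_mem_spanC hX) _ _ hw₁'
      exact (sub_eq_zero.1 h).symm)
  -- `T = 0` on `W_{μ̄ k₂} ≠ 0`: contradiction
  have hWa0 : Module.End.eigenspace (φ.baseChange ℂ) (starRingEnd ℂ (μ k₂)) ≠ ⊥ := fun h =>
    hn₀ (by rw [← hfina, h, finrank_bot])
  obtain ⟨w, hw, hw0⟩ := Submodule.exists_mem_ne_zero_of_ne_bot hWa0
  have hTw : (T ⟨w, hw⟩ : ℂ ⊗[ℚ] V) = 0 := by
    have h := hfapply (LinearEquiv.ofEq _ _ hWa'.symm ⟨w, hw⟩)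
    rw [hf0, LinearMap.zero_apply, Submodule.coe_zero] at h
    have h2 : LinearEquiv.ofEq _ _ hWa' (LinearEquiv.ofEq _ _ hWa'.symm ⟨w, hw⟩) = ⟨w, hw⟩ := by
      rw [← LinearEquiv.ofEq_symm hWa', LinearEquiv.apply_symm_apply]
    rw [h2] at h
    exact h.symm
  have hT0 : T ⟨w, hw⟩ = 0 := Subtype.ext hTw
  exact hw0 (congrArg Subtype.val ((LinearEquiv.map_eq_zero_iff T).1 hT0))

/-- **NO OUTER TWIST FOR A `K`-WEIL CM TYPE WITH TWO PLACES — `𝔤 = Lie Hg`, UNCONDITIONAL under the `K`-Weil balance.**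
`H` effective polarized of weight `1`, `E = End_Hdg(V) = ℚ[φ]`, CM type `μ` with `ι = {k₁, k₂}`, blocks of dimension `n₀ ≠ 0`,
`y ∈ E` `ψ`-skew acting by ONE scalar `ν ≠ 0` on the CM type (`K = ℚ(y)`, the CM type = the `K`-fibre), the `K`-Weil balance
`(p₁ − q₁) + (p₂ − q₂) = 0` (e.g. the pattern `(2,1)+(1,2)`), and `[Lie Hg, Lie Hg]_ℂ|_{W_{μk₁}} ⊇ 𝔰𝔩(W_{μk₁})`. Then no linear
isomorphism `W_{μ̄ k₂} ≃ W_{μ k₁}` intertwines `[Lie Hg, Lie Hg]_ℂ` — the residual `NoEqualSignatureTwist` of the cell's n₀ = 3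
NoTwist brick holds for these members («Lie Hg ⊆ 𝔰𝔲_K» by `CMThetaKWeil.trace_mul_eq_zero_of_mem_hodgeLie`, then §4).
[cite: MoonenZarhin1998WeilClasses, §4 Remark (1)] [cite: MoonenZarhin1999LowDim, §3 (3.1) and proof of Lemma (3.4)]
[cite: Ribet1983, §3] -/
theorem CMThetaKWeil.not_exists_intertwiner_conj_hodgeLie [Module.Finite ℚ V] [HodgeTensorFacts.{u, u}] {ι : Type}
    [Fintype ι] [DecidableEq ι] (H : HodgeStructure V n) (hn : n = 1) (heff : H.IsEffective) (ψ : H.Polarization)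
    {φ : Module.End ℚ V} (hφE : φ ∈ H.endAlg) {m : ℕ} (hE : ∀ a ∈ H.endAlg, ∃ q : Fin m → ℚ, a = ∑ k, q k • φ ^ (k : ℕ))
    (μ : ι → ℂ) (hinj : Function.Injective μ) (hdist : ∀ k k', μ k' ≠ starRingEnd ℂ (μ k)) {n₀ : ℕ} (hn₀ : n₀ ≠ 0)
    (hrank : ∀ k, Module.finrank ℂ ↥(Module.End.eigenspace (φ.baseChange ℂ) (μ k) ⊓ H.piece 1 0) +
      Module.finrank ℂ ↥(Module.End.eigenspace (φ.baseChange ℂ) (μ k) ⊓ H.piece 0 1) = n₀)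
    (htop : (⨆ kt : ι × Fin 2, Module.End.eigenspace (φ.baseChange ℂ)
      (if kt.2 = 0 then μ kt.1 else starRingEnd ℂ (μ kt.1))) = ⊤)
    {y : Module.End ℚ V} (hyE : y ∈ H.endAlg) (hyskew : ∀ v w, ψ.form (y v) w + ψ.form v (y w) = 0) {ν : ℂ} (hν : ν ≠ 0)
    (hyν : ∀ k, ∀ w ∈ Module.End.eigenspace (φ.baseChange ℂ) (μ k), y.baseChange ℂ w = ν • w)
    (k₁ k₂ : ι) (hk : k₁ ≠ k₂) (hι : ∀ k, k = k₁ ∨ k = k₂)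
    (hbal : ((Module.finrank ℂ ↥(Module.End.eigenspace (φ.baseChange ℂ) (μ k₁) ⊓ H.piece 1 0) : ℤ) -
        Module.finrank ℂ ↥(Module.End.eigenspace (φ.baseChange ℂ) (μ k₁) ⊓ H.piece 0 1)) +
      ((Module.finrank ℂ ↥(Module.End.eigenspace (φ.baseChange ℂ) (μ k₂) ⊓ H.piece 1 0) : ℤ) -
        Module.finrank ℂ ↥(Module.End.eigenspace (φ.baseChange ℂ) (μ k₂) ⊓ H.piece 0 1)) = 0)
    (hproj : ∀ Z : Module.End ℂ ↥(Module.End.eigenspace (φ.baseChange ℂ) (μ k₁)), LinearMap.trace ℂ _ Z = 0 →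
      ∃ X ∈ spanC (Submodule.span ℚ {B | ∃ X ∈ H.hodgeLie, ∃ X' ∈ H.hodgeLie, X * X' - X' * X = B}),
        ∀ w : ↥(Module.End.eigenspace (φ.baseChange ℂ) (μ k₁)), X w = Z w) :
    ¬ ∃ T : ↥(Module.End.eigenspace (φ.baseChange ℂ) (starRingEnd ℂ (μ k₂))) ≃ₗ[ℂ]
        ↥(Module.End.eigenspace (φ.baseChange ℂ) (μ k₁)),
      ∀ X ∈ spanC (Submodule.span ℚ {B | ∃ X ∈ H.hodgeLie, ∃ X' ∈ H.hodgeLie, X * X' - X' * X = B}),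
        ∀ w w₁ : ↥(Module.End.eigenspace (φ.baseChange ℂ) (starRingEnd ℂ (μ k₂))),
          (w₁ : ℂ ⊗[ℚ] V) = X w → (T w₁ : ℂ ⊗[ℚ] V) = X (T w) := by
  classical
  have hbalC : ∑ k, ν * (((Module.finrank ℂ ↥(Module.End.eigenspace (φ.baseChange ℂ) (μ k) ⊓ H.piece 1 0)) : ℂ) -
      (Module.finrank ℂ ↥(Module.End.eigenspace (φ.baseChange ℂ) (μ k) ⊓ H.piece 0 1) : ℂ)) = 0 := by
    have huniv : (Finset.univ : Finset ι) = {k₁, k₂} := by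
      ext k
      simp only [Finset.mem_univ, Finset.mem_insert, Finset.mem_singleton, true_iff]
      exact hι k
    rw [huniv, Finset.sum_insert (by rw [Finset.mem_singleton]; exact hk), Finset.sum_singleton, ← mul_add]
    have h := congrArg (fun z : ℤ => (z : ℂ)) hbal
    simp only [Int.cast_add, Int.cast_sub, Int.cast_natCast, Int.cast_zero] at h
    rw [h, mul_zero]
  have hy𝔤 := CMThetaKWeil.trace_mul_eq_zero_of_mem_hodgeLie H hn heff ψ hφE hE μ hinj hdist hrank htop hyE hyskew (fun _ => ν)
    hyν hbalC
  obtain ⟨Θ, hΘ⟩ := exists_hodgeTheta H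
  have hΘ𝔤 : Θ ∈ spanC H.hodgeLie := (hodgeLieC_eq_spanC H) ▸ H.mem_hodgeLieC_of_forall_piece hΘ
  exact CMThetaKWeil.not_exists_intertwiner_conj_of_traceOrthogonal H hn heff ψ hφE hE μ hinj hdist hn₀ hrank htop hyskew hν hyν
    k₁ k₂ hk hι H.hodgeLie (fun X hX X' hX' => H.commutator_mem_hodgeLie hX hX') (fun X hX a => H.commute_of_mem_hodgeLie hX a)
    (fun X hX => form_apply_add_eq_zero_of_mem_hodgeLie ψ hX) hΘ hΘ𝔤 hy𝔤 hproj

end HodgeStructure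

end Literature.AlgebraicGeometry.Motives

end
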